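import Literature.NumberTheory.Transcendental.HyperlogarithmsLogTaylor
import Literature.NumberTheory.Transcendental.HyperlogarithmsIntegrals
import HarnessLib

/-!
# Hyperlogarithms on `(0,1)`, IX: expansions at the top end-point for general alphabets

Ninth layer of the analytic road to `GenusZeroPeriodsMZV` (Brown 2009). For an admissible alphabet
`σ : α → {0} ∪ [1,∞)` and the fully regularised hyperlogarithms `L(b)_W = hlogSeries σ z b W` of
layer II, we PROVE that `s ↦ L(1-s)_W` has a logarithmic Taylor expansion at `s = 0⁺` of log-degree
`≤ |W|` (`Hyperlog.hasLogTaylor_hlogSeries_one_sub`), by induction on `W` along the reflected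
differential equation `d/ds L(1-s)_{cW'} = -ρ_c(1-s) L(1-s)_{W'}` and the primitive-closure
theorem of layer VIII: the reflected densities are `1/s` (letter at `1`), `1/(1-s)` (letter at
`0`) and `1/(τ-1+s)` (letter `τ > 1`, with SIGNED Taylor coefficients — no positivity is needed).
The coefficients `Hyperlog.topCoeff σ z W` are explicit (`stepCoeff`, `primCoeff`) up to one new
constant per word, the REGULARISED VALUE AT `1`, `Hyperlog.regTop σ z W := e_W(0,0)`
[Brown 2009, §5.2: "`Reg_{z=σ_i}`"]. Consequences: the regularised values
`Reg_{s=0⁺} s^j L(1-s)_W = e_W(-j, 0)` (`hasRegValue_zpow_mul_hlogSeries_one_sub`), uniqueness of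
logarithmic Taylor coefficients (`HasLogTaylor.unique`, from the asymptotic uniqueness of layer
VI), and the consistency check `regTop {0,1} W = Z(reg_ш W)` with the duality of layer V
(`regTop_boolLetters`). No named fact is introduced.

## References

* F. C. S. Brown, *Multiple zeta values and periods of moduli spaces `𝔐̄_{0,n}`*, Ann. Sci. Éc.
  Norm. Supér. (4) 42 (2009), 371–489, §5.2 (regularised values, expansions at the `σ_i`).
  doi:10.24033/asens.2099. [BrownENS2009]
-/

noncomputable section

open MeasureTheory intervalIntegral Set Filter
open scoped BigOperators Topology

namespace Literature.NumberTheory.Transcendental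

namespace Hyperlog

/-! ## Expansions of hyperlogarithms at the top end-point `1` for general alphabets -/

section Uniqueness

/-- Regularised values are unique. [folklore] -/
theorem HasRegValue.unique {φ : ℝ → ℝ} {c c' : ℝ} (h : HasRegValue φ c) (h' : HasRegValue φ c') : c = c' := by
  have h1 : HasRegValue (fun a => φ a + (-1) * φ a) (c + (-1) * c') := h.add (h'.smul (-1))
  have h2 : Tendsto (fun a : ℝ => φ a + (-1) * φ a) (𝓝[>] 0) (𝓝 0) :=
    (tendsto_const_nhds (x := (0 : ℝ))).congr fun a => by ring
  have := h1.eq_of_tendsto h2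
  linarith

/-- A polynomial in `log s` which tends to `0` as `s → 0⁺` is zero. [folklore] -/
theorem logPoly_eq_zero {N : ℕ} {d : ℕ → ℝ}
    (h : Tendsto (fun s : ℝ => ∑ κ ∈ Finset.range (N + 1), d κ * Real.log s ^ κ) (𝓝[>] 0) (𝓝 0)) :
    ∀ κ ∈ Finset.range (N + 1), d κ = 0 := by
  classical
  set S : Finset (ℤ × ℕ) := ((Finset.range (N + 1)).erase 0).image (fun κ => ((0 : ℤ), κ)) with hS
  have hinj : Set.InjOn (fun κ : ℕ => ((0 : ℤ), κ)) ((Finset.range (N + 1)).erase 0) := by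
    intro a _ b _ hab; simpa using hab
  have hsing : ∀ p ∈ S, IsSingular p := by
    intro p hp
    rw [hS, Finset.mem_image] at hp
    obtain ⟨κ, hκ, rfl⟩ := hp
    exact Or.inr ⟨rfl, Nat.pos_of_ne_zero (Finset.ne_of_mem_erase hκ)⟩
  have ht : Tendsto (fun s : ℝ => ∑ p ∈ S, (fun p : ℤ × ℕ => d p.2) p * (s ^ p.1 * Real.log s ^ p.2))
      (𝓝[>] 0) (𝓝 (0 - d 0)) := by
    have h2 := h.sub_const (d 0)
    refine h2.congr' ?_
    filter_upwards [self_mem_nhdsWithin] with s _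
    rw [hS, Finset.sum_image hinj, ← Finset.add_sum_erase _ _ (Finset.mem_range.2 (Nat.succ_pos N))]
    simp only [pow_zero, mul_one, zpow_zero, one_mul]
    ring
  obtain ⟨h0, hall⟩ := eq_zero_of_tendsto_singular S (fun p => d p.2) _ hsing ht
  intro κ hκ
  by_cases hk : κ = 0
  · subst hk; linarith
  · have := hall ((0 : ℤ), κ) (by rw [hS, Finset.mem_image]; exact ⟨κ, Finset.mem_erase.2 ⟨hk, hκ⟩, rfl⟩)
    exact this

/-- **Uniqueness of logarithmic Taylor coefficients.** [folklore] -/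
theorem HasLogTaylor.unique {φ : ℝ → ℝ} {c c' : ℕ → ℕ → ℝ} {n n' : ℕ} (h : HasLogTaylor φ c n)
    (h' : HasLogTaylor φ c' n') : ∀ m k, c m k = c' m k := by
  wlog hnn : n ≤ n' generalizing c c' n n'
  · intro m k; exact (this h' h (le_of_not_ge hnn) m k).symm
  have hd : HasLogTaylor (fun _ => (0 : ℝ)) (fun m k => c m k + (-1) * c' m k) n' := by
    have := (h.mono hnn).add (h'.smul (-1))
    exact this.congr (Eventually.of_forall fun s => by ring)
  set d : ℕ → ℕ → ℝ := fun m k => c m k + (-1) * c' m k with hdd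
  suffices hz : ∀ M, ∀ k, d M k = 0 by
    intro m k; have := hz m k; rw [hdd] at this; dsimp only at this; linarith
  intro M
  induction M using Nat.strong_induction_on with
  | _ M IH =>
    obtain ⟨C, hC⟩ := hd.2 M
    -- `T_M(s) = s^M Σ_κ d_{M,κ} log^κ s`
    have hT : ∀ s : ℝ, logTaylorSum d n' M s = s ^ M * ∑ κ ∈ Finset.range (n' + 1), d M κ * Real.log s ^ κ := by
      intro s
      unfold logTaylorSum
      rw [Finset.sum_range_succ, Finset.sum_eq_zero (fun μ hμ => ?_), zero_add, Finset.mul_sum]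
      · exact Finset.sum_congr rfl fun κ _ => by ring
      · exact Finset.sum_eq_zero fun κ _ => by rw [IH μ (Finset.mem_range.mp hμ) κ, zero_mul]
    have hlim : Tendsto (fun s : ℝ => ∑ κ ∈ Finset.range (n' + 1), d M κ * Real.log s ^ κ) (𝓝[>] 0) (𝓝 0) := by
      have h1 := (tendsto_zpow_mul_lam_pow (le_refl (1 : ℤ)) n').const_mul (|C|)
      rw [mul_zero] at h1
      refine squeeze_zero_norm' ?_ h1
      filter_upwards [hC, self_mem_nhdsWithin] with s hs hs0'
      have hs0 : 0 < s := hs0'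
      rw [zero_sub, abs_neg, hT s, abs_mul, abs_pow, abs_of_pos hs0] at hs
      rw [Real.norm_eq_abs, zpow_one]
      have hsM : 0 < s ^ M := pow_pos hs0 M
      refine le_of_mul_le_mul_left ?_ hsM
      calc s ^ M * |∑ κ ∈ Finset.range (n' + 1), d M κ * Real.log s ^ κ| ≤ C * (s ^ (M + 1) * (1 + |Real.log s|) ^ n') := hs
        _ ≤ |C| * (s ^ (M + 1) * (1 + |Real.log s|) ^ n') :=
            mul_le_mul_of_nonneg_right (le_abs_self C) (by positivity)
        _ = s ^ M * (|C| * (s * (1 + |Real.log s|) ^ n')) := by ring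
    intro k
    by_cases hk : k ≤ n'
    · exact logPoly_eq_zero hlim k (Finset.mem_range.2 (Nat.lt_succ_of_le hk))
    · exact hd.1 M k (not_le.mp hk)

end Uniqueness

section TopExpansion

/-- `1/(1-s) = Σ sⁱ` with remainder. [folklore] -/
theorem hasTaylor_inv_one_sub : HasTaylor (fun s : ℝ => (1 - s)⁻¹) (fun _ => 1) := by
  intro M
  refine ⟨2, ?_⟩
  filter_upwards [Ioo_mem_nhdsGT (by norm_num : (0 : ℝ) < 1 / 2)] with a ha
  have h1 : 1 - a ≠ 0 := by linarith [ha.2]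
  have hgeom : ∑ i ∈ Finset.range (M + 1), (1 : ℝ) * a ^ i = (1 - a ^ (M + 1)) * (1 - a)⁻¹ := by
    simp only [one_mul]
    rw [geom_sum_eq (fun h => h1 (by rw [h, sub_self])), ← neg_sub 1 (a ^ (M + 1)), ← neg_sub 1 a,
      neg_div_neg_eq, div_eq_mul_inv]
  rw [hgeom]
  have heq : (1 - a)⁻¹ - (1 - a ^ (M + 1)) * (1 - a)⁻¹ = a ^ (M + 1) * (1 - a)⁻¹ := by ring
  have hnn : 0 ≤ a ^ (M + 1) * (1 - a)⁻¹ :=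
    mul_nonneg (pow_nonneg ha.1.le _) (inv_nonneg.2 (by linarith [ha.2]))
  rw [heq, abs_of_nonneg hnn, mul_comm]
  refine mul_le_mul_of_nonneg_right ?_ (pow_nonneg ha.1.le _)
  rw [inv_le_comm₀ (by linarith [ha.2]) (by norm_num)]; linarith [ha.2]

/-- The partial geometric sums of `1/(τ-1+s)`: `Σ_{i ≤ M} (-1)ⁱ sⁱ/(τ-1)^{i+1} = (1 - (-s/(τ-1))^{M+1})/(τ-1+s)`.
[folklore] -/
theorem geom_sum_inv_sub_add {τ s : ℝ} (hτ : 1 < τ) (hs : 0 ≤ s) (M : ℕ) :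
    ∑ i ∈ Finset.range (M + 1), (-1 : ℝ) ^ i / (τ - 1) ^ (i + 1) * s ^ i =
      (1 - (-(s / (τ - 1))) ^ (M + 1)) / (τ - 1 + s) := by
  have hτ1 : τ - 1 ≠ 0 := by linarith
  have hτ1' : -1 + τ ≠ 0 := fun h => hτ1 (by linarith)
  have hτs : τ - 1 + s ≠ 0 := by linarith
  have hτs' : -1 + τ + s ≠ 0 := fun h => hτs (by linarith)
  induction M with
  | zero =>
    rw [Finset.sum_range_one, pow_one, zero_add, pow_one, pow_zero, pow_zero, mul_one, sub_neg_eq_add]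
    field_simp
  | succ M IH =>
    rw [Finset.sum_range_succ, IH]
    have hX : (-(s / (τ - 1))) ^ (M + 1 + 1) = (-(s / (τ - 1))) ^ (M + 1) * (-(s / (τ - 1))) := pow_succ _ _
    have hY : (-1 : ℝ) ^ (M + 1) / (τ - 1) ^ (M + 1 + 1) * s ^ (M + 1) = (-(s / (τ - 1))) ^ (M + 1) / (τ - 1) := by
      rw [neg_pow (s / (τ - 1)), div_pow, pow_succ (τ - 1) (M + 1)]
      field_simp
    rw [hX, hY]
    field_simp
    ring

/-- `1/(τ - 1 + s) = Σ (-1)ⁱ sⁱ/(τ-1)^{i+1}` with remainder, for `τ > 1`. [folklore] -/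
theorem hasTaylor_inv_sub_add {τ : ℝ} (hτ : 1 < τ) :
    HasTaylor (fun s : ℝ => (τ - 1 + s)⁻¹) (fun i => (-1) ^ i / (τ - 1) ^ (i + 1)) := by
  intro M
  have hτ1 : 0 < τ - 1 := by linarith
  refine ⟨1 / (τ - 1) ^ (M + 2), ?_⟩
  filter_upwards [self_mem_nhdsWithin] with s hs
  have hs0 : 0 < s := hs
  have hτs : 0 < τ - 1 + s := by linarith
  rw [geom_sum_inv_sub_add hτ hs0.le M]
  have hdiff : (τ - 1 + s)⁻¹ - (1 - (-(s / (τ - 1))) ^ (M + 1)) / (τ - 1 + s) =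
      (-(s / (τ - 1))) ^ (M + 1) / (τ - 1 + s) := by
    field_simp; ring
  rw [hdiff, abs_div, abs_of_pos hτs, abs_pow, abs_neg, abs_of_nonneg (div_nonneg hs0.le hτ1.le), div_pow]
  calc s ^ (M + 1) / (τ - 1) ^ (M + 1) / (τ - 1 + s) ≤ s ^ (M + 1) / (τ - 1) ^ (M + 1) / (τ - 1) := by
        refine div_le_div_of_nonneg_left (by positivity) hτ1 (by linarith)
    _ = 1 / (τ - 1) ^ (M + 2) * s ^ (M + 1) := by rw [pow_succ (τ - 1) (M + 1)]; field_simp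

variable {α : Type*} {σ : α → ℝ}

/-- The reflected density of a letter at `0`: `1/|1-s-0| = 1/(1-s)` on `(0,1)`. [folklore] -/
theorem pden_one_sub_of_eq_zero {c : α} (hc : σ c = 0) {s : ℝ} (hs : s ∈ Ioo (0 : ℝ) 1) :
    pden σ c (1 - s) = (1 - s)⁻¹ := by
  rw [pden_of_eq_zero (σ := σ) hc (by linarith [hs.2]), one_div]

variable {z : α} (hz : σ z = 0) (hσz : ∀ c, c ≠ z → 1 ≤ σ c)
include hz hσz

/-- The reflected density of a letter `τ ≥ 1`: `1/|1-s-τ| = 1/(τ-1+s)` on `(0,1)`. [folklore] -/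
theorem pden_one_sub_of_ne_zero {c : α} (hc : σ c ≠ 0) {s : ℝ} (hs : s ∈ Ioo (0 : ℝ) 1) :
    pden σ c (1 - s) = (σ c - 1 + s)⁻¹ := by
  rw [pden_of_ne_zero (adm_of_zero_letter σ hz hσz) hc (by linarith [hs.1]), one_div]
  congr 1; ring

omit hz hσz in
/-- The Taylor data at `s = 0` of `-s · (reflected density)` for a letter not at `1`:
`-s/(1-s) = -Σ_{i≥1} sⁱ` (letter `0`), `-s/(τ-1+s) = Σ_{i ≥ 1} (-1)^i s^i/(τ-1)^i` (letter `τ > 1`).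
[folklore] -/
def reflTaylor (σ : α → ℝ) (c : α) (i : ℕ) : ℝ :=
  if i = 0 then 0 else if σ c = 0 then -1 else (-1) ^ i / (σ c - 1) ^ i

omit hz hσz in
open Finset in
/-- The coefficients of `h = -s ρ_c(1-s) · L(1-s)_{W'}` from those of `L(1-s)_{W'}`, for a letter
`c` not at `1`; and `h = -L(1-s)_{W'}` for a letter at `1`. [folklore] -/
def stepCoeff (σ : α → ℝ) (c : α) (e : ℕ → ℕ → ℝ) (m k : ℕ) : ℝ :=
  if σ c = 1 then -e m k else ∑ ij ∈ antidiagonal m, reflTaylor σ c ij.1 * e ij.2 k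

/-- `h = -s ρ_c(1-s) L(1-s)_{W'}` has the coefficients `stepCoeff`. [folklore] -/
theorem hasLogTaylor_step {c : α} {φ : ℝ → ℝ} {e : ℕ → ℕ → ℝ} {n : ℕ} (hφ : HasLogTaylor φ e n) :
    HasLogTaylor (fun s => -(s * pden σ c (1 - s)) * φ s) (stepCoeff σ c e) n := by
  classical
  by_cases h1 : σ c = 1
  · have h := hφ.smul (-1)
    refine (h.congr ?_).congr_coeff fun m k => ?_
    · filter_upwards [Ioo_mem_nhdsGT (zero_lt_one' ℝ)] with s hs
      rw [pden_one_sub_of_ne_zero hz hσz (c := c) (by rw [h1]; norm_num) hs, h1]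
      have : (1 : ℝ) - 1 + s = s := by ring
      rw [this, mul_inv_cancel₀ hs.1.ne']
    · simp [stepCoeff, h1]
  · -- `ρ(s) := -s ρ_c(1-s)` has Taylor coefficients `reflTaylor σ c`
    have hρ : HasTaylor (fun s => -(s * pden σ c (1 - s))) (reflTaylor σ c) := by
      by_cases h0 : σ c = 0
      · -- `-s/(1-s)`
        have h := (hasTaylor_inv_one_sub.hasLogTaylor.mul_self.smul (-1))
        have h' : HasLogTaylor (fun s => -(s * pden σ c (1 - s)))
            (fun m k => (-1) * if m = 0 then 0 else if k = 0 then (1 : ℝ) else 0) 0 := by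
          refine h.congr ?_
          filter_upwards [Ioo_mem_nhdsGT (zero_lt_one' ℝ)] with s hs
          rw [pden_one_sub_of_eq_zero h0 hs]; ring
        intro M
        obtain ⟨C, hC⟩ := h'.2 M
        refine ⟨C, ?_⟩
        filter_upwards [hC] with s hs
        have hsum : logTaylorSum (fun m k => (-1) * if m = 0 then 0 else if k = 0 then (1 : ℝ) else 0) 0 M s =
            ∑ i ∈ Finset.range (M + 1), reflTaylor σ c i * s ^ i := by
          unfold logTaylorSum
          refine Finset.sum_congr rfl fun m _ => ?_
          rw [Finset.sum_range_one]
          simp only [reflTaylor, h0, if_true, pow_zero, mul_one]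
          split_ifs <;> ring
        rw [hsum, pow_zero, mul_one] at hs
        exact hs
      · -- `-s/(τ-1+s)`, `τ > 1`
        have hτ : 1 < σ c := lt_of_le_of_ne (hσz c fun h => h0 (h ▸ hz)) (Ne.symm h1)
        have h := ((hasTaylor_inv_sub_add hτ).hasLogTaylor.mul_self.smul (-1))
        have h' : HasLogTaylor (fun s => -(s * pden σ c (1 - s)))
            (fun m k => (-1) * if m = 0 then 0 else if k = 0 then (-1) ^ (m - 1) / (σ c - 1) ^ (m - 1 + 1) else 0) 0 := by
          refine h.congr ?_
          filter_upwards [Ioo_mem_nhdsGT (zero_lt_one' ℝ)] with s hs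
          rw [pden_one_sub_of_ne_zero hz hσz h0 hs]; ring
        intro M
        obtain ⟨C, hC⟩ := h'.2 M
        refine ⟨C, ?_⟩
        filter_upwards [hC] with s hs
        have hsum : logTaylorSum (fun m k => (-1) * if m = 0 then 0 else
            if k = 0 then (-1) ^ (m - 1) / (σ c - 1) ^ (m - 1 + 1) else 0) 0 M s =
            ∑ i ∈ Finset.range (M + 1), reflTaylor σ c i * s ^ i := by
          unfold logTaylorSum
          refine Finset.sum_congr rfl fun m _ => ?_
          rw [Finset.sum_range_one]
          simp only [reflTaylor, h0, if_false, if_true, pow_zero, mul_one]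
          by_cases hm : m = 0
          · simp [hm]
          · rw [if_neg hm, if_neg hm]
            obtain ⟨m', rfl⟩ := Nat.exists_eq_succ_of_ne_zero hm
            simp only [Nat.succ_sub_one, pow_succ]
            ring
        rw [hsum, pow_zero, mul_one] at hs
        exact hs
    have h := hρ.mul_hasLogTaylor hφ
    refine h.congr_coeff fun m k => ?_
    simp [stepCoeff, h1]

variable [DecidableEq α]

/-- **The top expansion data**: for every word `W`, coefficients `e_W` with
`L(1-s)_W = Σ e_W(m,k) s^m log^k s + O(⋯)`, constructed by the primitive-closure theorem along the
reflected differential equation `d/ds L(1-s)_{cW'} = -ρ_c(1-s) L(1-s)_{W'}`. [folklore] -/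
def topData : ∀ W : List α,
    {e : ℕ → ℕ → ℝ // HasLogTaylor (fun s => hlogSeries σ z (1 - s) W) e W.length}
  | [] => ⟨fun m k => if k = 0 then (if m = 0 then 1 else 0) else 0, by
      have h : HasTaylor (fun _ : ℝ => (1 : ℝ)) (fun m => if m = 0 then 1 else 0) :=
        hasTaylor_of_finite 0 (fun i hi => if_neg (by omega)) (Eventually.of_forall fun a => by simp)
      refine h.hasLogTaylor.congr ?_
      filter_upwards [Ioo_mem_nhdsGT (zero_lt_one' ℝ)] with s hs
      exact (hlogSeries_nil hz hσz ⟨by linarith [hs.2], by linarith [hs.1]⟩).symm⟩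
  | c :: W' => by
      have IH := (topData W').2
      have hstep := hasLogTaylor_step hz hσz (c := c) IH
      have hex := hasLogTaylor_of_hasDerivAt (φ := fun s => hlogSeries σ z (1 - s) (c :: W')) hstep zero_lt_one
        (fun s hs => by
          have hs' : 1 - s ∈ Ioo (0 : ℝ) 1 := ⟨by linarith [hs.2], by linarith [hs.1]⟩
          have h := (hasDerivAt_hlogSeries_cons hz hσz c W' hs').scomp s ((hasDerivAt_id s).const_sub 1)
          refine h.congr_deriv ?_
          simp only [smul_eq_mul]
          field_simp [hs.1.ne'])
      exact ⟨primCoeff (stepCoeff σ c (topData W').1) W'.length (Classical.choose hex),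
        by simpa using Classical.choose_spec hex⟩

/-- The top expansion coefficients `e_W`. [folklore] -/
def topCoeff (W : List α) : ℕ → ℕ → ℝ := (topData hz hσz W).1

/-- **Every hyperlogarithm has a logarithmic Taylor expansion at the top end-point** `1`, of
log-degree at most the length of the word. [cite: BrownENS2009, §5.2 (expansions at `σ_i`)] -/
theorem hasLogTaylor_hlogSeries_one_sub (W : List α) :
    HasLogTaylor (fun s => hlogSeries σ z (1 - s) W) (topCoeff hz hσz W) W.length :=
  (topData hz hσz W).2

/-- **The regularised value at `1`** of `L(b)_W`: `Reg_{b→1⁻} L(b)_W := e_W(0,0)`. [folklore] -/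
def regTop (W : List α) : ℝ := topCoeff hz hσz W 0 0

/-- Regularised values of `s^j L(1-s)_W` at `s = 0⁺`. [folklore] -/
theorem hasRegValue_zpow_mul_hlogSeries_one_sub (j : ℤ) (W : List α) :
    HasRegValue (fun s => s ^ j * hlogSeries σ z (1 - s) W)
      (if j ≤ 0 then topCoeff hz hσz W (-j).toNat 0 else 0) :=
  (hasLogTaylor_hlogSeries_one_sub hz hσz W).hasRegValue_zpow_mul j

omit hz hσz in
/-- For the alphabet `{0,1}` the regularised value at `1` is `Z(reg_ш W)` (consistency with the
duality of layer V). [folklore] -/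
theorem regTop_boolLetters (W : List Bool) :
    regTop (σ := boolLetters) (z := false) rfl boolLetters_adm' W = MZV.zetaWordSum (MZV.shuffleReg W) := by
  have h1 := hasRegValue_zpow_mul_hlogSeries_one_sub (σ := boolLetters) (z := false) rfl boolLetters_adm' 0 W
  simp only [le_refl, if_true, neg_zero, Int.toNat_zero] at h1
  have h2 := hasRegValue_hev_one_sub (Finsupp.single (Bfn.pow 0, W) 1)
  have h2' : HasRegValue (fun s => s ^ (0 : ℤ) * hlogSeries boolLetters false (1 - s) W)
      (reg1 (Finsupp.single (Bfn.pow 0, W) 1)) := by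
    refine h2.congr (Eventually.of_forall fun s => ?_)
    rw [hev_single, zpow_zero]; simp [bval]
  have h3 : reg1 (Finsupp.single (Bfn.pow 0, W) 1) = MZV.zetaWordSum (MZV.shuffleReg W) := by
    unfold reg1
    rw [Finsupp.sum_single_index (by simp)]
    simp only [Rat.cast_one, one_mul]
    rw [Finset.sum_eq_single_of_mem (([] : List Bool), W) (NCSeries.nil_self_mem_splits W) (fun p hp hne => ?_)]
    · simp [reg1B]
    · have : p.1 ≠ [] := by
        intro h; apply hne
        rw [NCSeries.mem_splits] at hp
        ext1
        · exact h
        · simpa [h] using hp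
      simp [reg1B, this]
  rw [h3] at h2'
  exact h1.unique h2'

end TopExpansion

end Hyperlog

end Literature.NumberTheory.Transcendental
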